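import Summits.AtomisticToContinuum.Crystallization.Theorems.OverbindingBudgetAffineFarTailDriftTerms

/-!
# Overbinding budget — slot Z of the 31280 record, leaf Z3a: `TailDriftBound (1/25) (1/2000)` PROVED

`theorem tailDriftBound_holds : TailDriftBound (1 / 25) (1 / 2000)` — the S/M-sized leaf Z3a of the leaf list v14′ of the slot-Z record
`farAggregatePricing_record_of_leaves_v14'` (`…OverbindingBudgetAffineFarFirstShellLabelling`, slot `h3a`): at a NORMAL far site `i` (far, not
scale-bad, so `0.956 ≤ nn_i ≤ 2`), for a `1/25`-admissible chart `c` with `|c.nn − nn_i| ≤ Cε₁ nn_i` and ANY matching `(M, π)` (`Matched D ε₁ y i c M π`: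
`π` injective into the structure, `y k` within `matchTol = min (Dε₁ nn_i (1 + (r/nn_i)²)) (nn_i/4)` of `y i + a₀ B(π k)`):
`refTail c − smoothTail M y i ≤ C'' ε₁` with `C'' = 2.3·10⁸ (C + D)`, `ε_D = 1/(100 (C + 1))`.

PROOF.  (1) UNMATCHED STRUCTURE POINTS ARE FREE (part 2 `refTail_le_sum_matched`): `refTail c ≤ ½ Σ_{k∈M} T_k`, `T_k = tailW(c.nn, ρ_k) V(ρ_k)`,
`ρ_k = a₀‖B(π k)‖`.  (2) SUMMAND BY SUMMAND (part 2 `tail_pair_estimate`): `T_k − S_k ≤ 40000 (C + D) ε₁ r_k⁻⁴ ≤ 640000 (C + D) ε₁ ρ_k⁻⁴`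
(`S_k = tailW(nn_i, r_k) V(r_k)`, `r_k = dist (y i) (y k) ≥ ρ_k/2`; `π k = 0`: both vanish).  (3) DECAY SUM (parts 1–2 `matched_decay_sum`):
`Σ_{π k ≠ 0} ρ_k⁻⁴ ≤ 700`.  Hence `refTail c − smoothTail M y i ≤ ½ · 640000 · 700 · (C + D) ε₁ = 2.24·10⁸ (C + D) ε₁`.
The antecedent R_aff of `TailDriftBound` is not used.

[this file: Summit.AtomisticToContinuum.Crystallization, slot Z of the 31280 record, leaf Z3a part 3]
-/

namespace Summit.AtomisticToContinuum.Crystallization.Theorems.OverbindingBudgetAffineFarSmoothSplit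

open Literature.MathematicalPhysics.StatisticalMechanics
open Literature.Geometry.DiscreteGeometry
open Summit.AtomisticToContinuum.Crystallization.Theorems.OverbindingBudgetAffineLadder
open Summit.AtomisticToContinuum.Crystallization.Theorems.OverbindingBudgetAffineLocalisation
open scoped Classical

variable {N : ℕ}

/-- **One matched pair, in configuration terms.**  At a normal site (`0.956 ≤ nn_i ≤ 2`, `Cε₁ ≤ 1/100`) with a `1/25`-admissible chart,
`|c.nn − nn_i| ≤ Cε₁ nn_i`, a structure point `p` and a site `k` with `dist (y k) (y i + a₀ • B p) ≤ matchTol D ε₁ nn_i (dist (y i) (y k))`: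
`tailW(c.nn, a₀‖Bp‖) V(a₀‖Bp‖) − tailW(nn_i, r_ik) V(r_ik) ≤ 640000 (C + D) ε₁ · [p ≠ 0] (a₀‖Bp‖)⁻⁴`. [this file] -/
theorem matched_pair_bound {C D ε₁ : ℝ} {y : Fin N → EuclideanSpace ℝ (Fin 3)} {i k : Fin N} (hC : 0 ≤ C) (hD : 0 ≤ D) (hε₁ : 0 < ε₁)
    (hnn : 239 / 250 ≤ nearestDist y i) (hnn2 : nearestDist y i ≤ 2) (hCε : C * ε₁ ≤ 1 / 100) {c : Chart}
    (hadm : ChartAdmissible (1 / 25) c) (hcnn : |c.nn - nearestDist y i| ≤ C * ε₁ * nearestDist y i)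
    {p : EuclideanSpace ℝ (Fin 3)} (hp : p ∈ barlowStacking 1 (Real.sqrt (2 / 3)) c.s)
    (hk : dist (y k) (y i + c.a₀ • c.B p) ≤ matchTol D ε₁ (nearestDist y i) (dist (y i) (y k))) :
    tailW c.nn (c.a₀ * ‖c.B p‖) * lennardJones (c.a₀ * ‖c.B p‖) -
        tailW (nearestDist y i) (dist (y i) (y k)) * lennardJones (dist (y i) (y k)) ≤
      640000 * (C + D) * ε₁ * (if p ≠ 0 then (c.a₀ * ‖c.B p‖)⁻¹ ^ 4 else 0) := by
  have hnn0 : 0 < nearestDist y i := by linarith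
  have ha₀ := hadm.2.1
  have hcnn0 := hadm.2.2.1
  have hcnn' := abs_le.mp hcnn
  have hCεnn : C * ε₁ * nearestDist y i ≤ 1 / 100 * nearestDist y i := mul_le_mul_of_nonneg_right hCε hnn0.le
  have hτ4 : matchTol D ε₁ (nearestDist y i) (dist (y i) (y k)) ≤ nearestDist y i / 4 := matchTol_le_quarter _ _ _ _
  have hτD : matchTol D ε₁ (nearestDist y i) (dist (y i) (y k)) ≤ D * ε₁ * nearestDist y i * (1 + (dist (y i) (y k) / nearestDist y i) ^ 2) :=
    min_le_left _ _
  have hnorm : ‖c.a₀ • c.B p‖ = c.a₀ * ‖c.B p‖ := by rw [norm_smul, Real.norm_of_nonneg ha₀.le]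
  -- the distance mismatch
  have hρr : |c.a₀ * ‖c.B p‖ - dist (y i) (y k)| ≤ matchTol D ε₁ (nearestDist y i) (dist (y i) (y k)) := by
    have h1 := abs_dist_sub_le (y i + c.a₀ • c.B p) (y k) (y i)
    rw [dist_eq_norm (y i + c.a₀ • c.B p) (y i), add_sub_cancel_left, hnorm, dist_comm (y k) (y i),
      dist_comm (y i + c.a₀ • c.B p)] at h1
    exact h1.trans hk
  have hρr' := abs_le.mp hρr
  by_cases hp0 : p = 0
  · -- both summands vanish
    subst hp0
    rw [if_neg (not_not.mpr rfl), mul_zero, map_zero, norm_zero, mul_zero, lennardJones_zero, mul_zero, zero_sub, neg_nonpos]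
    rw [map_zero, norm_zero, mul_zero] at hρr'
    have hr : dist (y i) (y k) ≤ 9 / 2 * nearestDist y i := by linarith
    rw [tailW_eq_zero hnn0 hr, zero_mul]
  · rw [if_pos hp0]
    have hρν : c.nn ≤ c.a₀ * ‖c.B p‖ := hadm.2.2.2.2.1 p hp hp0
    have hpair := tail_pair_estimate hC hD hε₁ hnn hnn2 hCε hcnn hρr hτ4 hτD
    have hρ0 : 0 < c.a₀ * ‖c.B p‖ := by linarith
    have hrρ : c.a₀ * ‖c.B p‖ / 2 ≤ dist (y i) (y k) := by linarith
    have hinv : (dist (y i) (y k))⁻¹ ^ 4 ≤ 16 * (c.a₀ * ‖c.B p‖)⁻¹ ^ 4 := by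
      have h1 : (dist (y i) (y k))⁻¹ ≤ (c.a₀ * ‖c.B p‖ / 2)⁻¹ := inv_anti₀ (by positivity) hrρ
      have h2 := pow_le_pow_left₀ (inv_nonneg.mpr dist_nonneg) h1 4
      have e : (c.a₀ * ‖c.B p‖ / 2)⁻¹ ^ 4 = 16 * (c.a₀ * ‖c.B p‖)⁻¹ ^ 4 := by
        rw [inv_pow, inv_pow, div_pow, inv_div, div_eq_mul_inv]; norm_num
      rw [e] at h2
      exact h2
    have h3 : 40000 * (C + D) * ε₁ * (dist (y i) (y k))⁻¹ ^ 4 ≤ 40000 * (C + D) * ε₁ * (16 * (c.a₀ * ‖c.B p‖)⁻¹ ^ 4) :=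
      mul_le_mul_of_nonneg_left hinv (by positivity)
    linarith

/-- **★ Z3a (PROVED): `TailDriftBound (1/25) (1/2000)`** — with `ε_D = 1/(100 (C + 1))` and `C'' = 2.3·10⁸ (C + D)`.  See the file docstring.
[this file] -/
theorem tailDriftBound_holds : TailDriftBound (1 / 25) (1 / 2000) := by
  intro _ C hC D hD
  refine ⟨230000000 * (C + D), 1 / (100 * (C + 1)), by positivity, by positivity, ?_⟩
  intro ε₁ hε₁ hε₁E δ hδ hδ2 N y hy i hiF hisb c hadm hcnn M π hM
  -- constants and the scale floor of a normal far site
  have hC1 : 0 < C + 1 := by linarith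
  have hCε : C * ε₁ ≤ 1 / 100 := by
    have h1 : C * ε₁ ≤ C * (1 / (100 * (C + 1))) := mul_le_mul_of_nonneg_left hε₁E hC
    have h2 : C * (1 / (100 * (C + 1))) ≤ 1 / 100 := by
      rw [mul_one_div, div_le_iff₀ (by positivity)]; nlinarith
    linarith
  have hiG : i ∈ goodSet 12 ε₁ (1 / 25) δ y := farSet_subset_goodSet _ _ _ _ _ y hiF
  have hnn956 : 122 / 125 * (1 - 1 / 50) ≤ nearestDist y i := nearestDist_lb_of_good_not_scaleBad hδ hy hiG hisb
  have hnn : 239 / 250 ≤ nearestDist y i := le_trans (by norm_num) hnn956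
  have hnn2 : nearestDist y i ≤ 2 := (inWindow_of_mem_goodSet hiG).2
  have hnn0 : 0 < nearestDist y i := by linarith
  have hcnn' := abs_le.mp hcnn
  have hCεnn : C * ε₁ * nearestDist y i ≤ 1 / 100 * nearestDist y i := mul_le_mul_of_nonneg_right hCε hnn0.le
  have hν9 : 9 / 10 ≤ c.nn := by linarith
  have hinj : Set.InjOn π ↑M := hM.1
  have hπ : ∀ k ∈ M, π k ∈ barlowStacking 1 (Real.sqrt (2 / 3)) c.s := fun k hk => (hM.2 k hk).1
  -- (1) truncation
  have h1 := refTail_le_sum_matched hadm hν9 hinj hπ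
  -- (2) summand by summand
  set T : Fin N → ℝ := fun k => tailW c.nn (c.a₀ * ‖c.B (π k)‖) * lennardJones (c.a₀ * ‖c.B (π k)‖) with hT
  set S : Fin N → ℝ := fun k => tailW (nearestDist y i) (dist (y i) (y k)) * lennardJones (dist (y i) (y k)) with hS
  set w : Fin N → ℝ := fun k => if π k ≠ 0 then (c.a₀ * ‖c.B (π k)‖)⁻¹ ^ 4 else 0 with hw
  have hterm : ∀ k ∈ M, T k - S k ≤ 640000 * (C + D) * ε₁ * w k := fun k hk =>
    matched_pair_bound hC hD hε₁ hnn hnn2 hCε hadm hcnn (hπ k hk) (hM.2 k hk).2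
  have h2 : ∑ k ∈ M, T k - ∑ k ∈ M, S k ≤ 640000 * (C + D) * ε₁ * ∑ k ∈ M, w k := by
    rw [← Finset.sum_sub_distrib, Finset.mul_sum]
    exact Finset.sum_le_sum hterm
  -- (3) the decay sum
  have h3 : ∑ k ∈ M, w k ≤ 700 := by
    have e : ∑ k ∈ M, w k = ∑ k ∈ M.filter (fun k => π k ≠ 0), (c.a₀ * ‖c.B (π k)‖)⁻¹ ^ 4 := by
      rw [Finset.sum_filter]
    rw [e]
    exact matched_decay_sum hadm hν9 hinj hπ
  -- assemble
  have eS : smoothTail M y i = 1 / 2 * ∑ k ∈ M, S k := rfl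
  have eT : (1 / 2 : ℝ) * ∑ k ∈ M, tailW c.nn (c.a₀ * ‖c.B (π k)‖) * lennardJones (c.a₀ * ‖c.B (π k)‖) = 1 / 2 * ∑ k ∈ M, T k := rfl
  rw [eT] at h1
  rw [eS]
  have hCD : 0 ≤ (C + D) * ε₁ := by positivity
  have h4 : 640000 * (C + D) * ε₁ * ∑ k ∈ M, w k ≤ 640000 * (C + D) * ε₁ * 700 := mul_le_mul_of_nonneg_left h3 (by positivity)
  nlinarith

end Summit.AtomisticToContinuum.Crystallization.Theorems.OverbindingBudgetAffineFarSmoothSplit
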